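import Mathlib.RingTheory.DiscreteValuationRing.Basic
import Mathlib.RingTheory.Multiplicity
import Mathlib.RingTheory.UniqueFactorizationDomain.Multiplicity
import Mathlib.RingTheory.Localization.AtPrime.Basic
import Mathlib.RingTheory.IntegralClosure.IntegrallyClosed
import Mathlib.Algebra.CharP.Lemmas
import Literature.AlgebraicGeometry.Resolution.KummerNormalForm
import HarnessLib

/-!
# The type of a purely inseparable `p`-cyclic cover along a prime divisor: Kummer or wound

Topic: `Literature/AlgebraicGeometry/Resolution`. DEFINITIONS with their basic theory. For the
purely inseparable cover `T^p = a` of a regular scheme of characteristic `p` and a prime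
divisor `D = V(ϖ)` along which `a` is in normal form (J. Giraud, *Forme normale d'une fonction
sur une surface de caractéristique positive*, Bull. SMF 111 (1983), Déf. 1.2, Prop. 1.5), the
germ of `a` in the discrete valuation ring `𝒪_{W,η_D}` has exactly one of two shapes:

* **Kummer type** (`IsKummerTypeAt p ϖ a`): `a = g^p + v ϖ^A` with `v` a unit and `p ∤ A`
  — the normalised cover is totally ramified along `D` (`w^p = v ϖ^A`);
* **wound type** (`IsWoundTypeAt p ϖ a`): `a = g^p + ϖ^{pB} u` with `u` not a `p`-th power
  modulo `ϖ` (`∀ c, ϖ ∤ u - c^p`) — the normalised cover `t'^p = u`, `t' = (t - g)/ϖ^B`, is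
  unramified along `D` with purely inseparable residue extension `κ(D)(ū^{1/p})`.

The two types exclude each other (`IsWoundTypeAt.not_isKummerTypeAt`: compare `ϖ`-adic orders
of `a - h^p`, which are `A ≢ 0 (mod p)` in the first case and multiples of `p` in the second).
This is the invariant that makes the pointwise Giraud normal forms at the various points of `D`
cohere (the type of `D` can be read off at any point of `D`), used by the endgame of the crux
`PicoverLocalModel` (line `giraud-cossart-normal-form`) to show that near a Kummer centre the
boundary components with exponent divisible by `p` carry only wound/transversal points.

Also proved: the multiplicity obstruction to being a `p`-th power in a fraction field
(`dvd_of_mul_pow_eq_pow`: if `y t^p = s^p` with `t ≠ 0` then `p ∣ mult_π(y)` for every prime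
`π`), by which woundness along `D` is checked inside the regular ring `𝒪_D`.

What is NOT here: the passage from a Giraud normal form at a point to the types of the boundary
components through it (regular local rings; Theorems side), valuations of function fields.

Sources: [Giraud1983] J. Giraud, Bull. SMF 111 (1983) 109–124, Déf. 1.2, Prop. 1.5.
[Kato1994] K. Kato, *Toric singularities*, Amer. J. Math. 116 (1994), (2.2)(2) (the Kummer
cover along an snc divisor is log regular).
-/

namespace Literature.AlgebraicGeometry.Resolution

variable {D : Type*} [CommRing D]

/-- **Kummer type** of `a` along `ϖ` at the exponent `p`: `a = g^p + v · ϖ^A` with `v` a unit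
and `p ∤ A` (the cover `T^p = a` is totally ramified along `V(ϖ)`).
[cite: Giraud1983, Prop. 1.5] -/
def IsKummerTypeAt (p : ℕ) (ϖ a : D) : Prop :=
  ∃ (g v : D) (A : ℕ), IsUnit v ∧ ¬ p ∣ A ∧ a = g ^ p + v * ϖ ^ A

/-- **Wound type** of `a` along `ϖ` at the exponent `p`: `a = g^p + ϖ^{pB} · u` with `u` not a
`p`-th power modulo `ϖ` (the cover `T^p = a` is unramified along `V(ϖ)` with purely
inseparable residue field extension). [cite: Giraud1983, Prop. 1.5] -/
def IsWoundTypeAt (p : ℕ) (ϖ a : D) : Prop :=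
  ∃ (g u : D) (B : ℕ), (∀ c : D, ¬ ϖ ∣ u - c ^ p) ∧ a = g ^ p + ϖ ^ (p * B) * u

/-- Unfolding `IsKummerTypeAt` (`rfl`). [folklore] -/
theorem isKummerTypeAt_iff {p : ℕ} {ϖ a : D} :
    IsKummerTypeAt p ϖ a ↔ ∃ (g v : D) (A : ℕ), IsUnit v ∧ ¬ p ∣ A ∧ a = g ^ p + v * ϖ ^ A :=
  Iff.rfl

/-- Unfolding `IsWoundTypeAt` (`rfl`). [folklore] -/
theorem isWoundTypeAt_iff {p : ℕ} {ϖ a : D} :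
    IsWoundTypeAt p ϖ a ↔
      ∃ (g u : D) (B : ℕ), (∀ c : D, ¬ ϖ ∣ u - c ^ p) ∧ a = g ^ p + ϖ ^ (p * B) * u :=
  Iff.rfl

/-- The unit of a wound form is not divisible by `ϖ` (take `c = 0`). [folklore] -/
theorem not_dvd_of_forall_not_dvd_sub_pow {p : ℕ} (hp : p ≠ 0) {ϖ u : D}
    (hu : ∀ c : D, ¬ ϖ ∣ u - c ^ p) : ¬ ϖ ∣ u := by
  simpa [zero_pow hp] using hu 0

/-- Both types are insensitive to translating `a` by a `p`-th power: Kummer case.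
[folklore] -/
theorem IsKummerTypeAt.add_pow {p : ℕ} [Fact p.Prime] [CharP D p] {ϖ a : D}
    (h : IsKummerTypeAt p ϖ a) (b : D) : IsKummerTypeAt p ϖ (a + b ^ p) := by
  obtain ⟨g, v, A, hv, hA, rfl⟩ := h
  exact ⟨g + b, v, A, hv, hA, by rw [add_pow_char]; ring⟩

/-- Both types are insensitive to translating `a` by a `p`-th power: wound case. [folklore] -/
theorem IsWoundTypeAt.add_pow {p : ℕ} [Fact p.Prime] [CharP D p] {ϖ a : D}
    (h : IsWoundTypeAt p ϖ a) (b : D) : IsWoundTypeAt p ϖ (a + b ^ p) := by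
  obtain ⟨g, u, B, hu, rfl⟩ := h
  exact ⟨g + b, u, B, hu, by rw [add_pow_char]; ring⟩

section DVR

variable [IsDomain D] [IsDiscreteValuationRing D]

/-- In a discrete valuation ring with uniformizer `ϖ`: if `ϖ^{pB}` divides a `p`-th power
`δ^p` (`0 < p`) then `ϖ^B ∣ δ`. [folklore] -/
theorem pow_dvd_of_pow_mul_dvd_pow {ϖ : D} (hϖ : Irreducible ϖ) {p : ℕ} (hp : 0 < p) {B : ℕ}
    {δ : D} (h : ϖ ^ (p * B) ∣ δ ^ p) : ϖ ^ B ∣ δ := by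
  by_cases hδ : δ = 0
  · rw [hδ]; exact dvd_zero _
  obtain ⟨n, w, rfl⟩ := IsDiscreteValuationRing.eq_unit_mul_pow_irreducible hδ hϖ
  rcases le_or_gt B n with hBn | hnB
  · exact Dvd.intro_left ((w : D) * ϖ ^ (n - B)) (by
      rw [mul_assoc, ← pow_add, Nat.sub_add_cancel hBn])
  · exfalso
    have hprime : Prime ϖ := hϖ.prime
    -- cancel `ϖ^{pn}`: `ϖ^{p(B-n)} ∣ w^p`
    have hsplit : ϖ ^ (p * B) = ϖ ^ (p * n) * ϖ ^ (p * (B - n)) := by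
      rw [← pow_add, ← Nat.mul_add, Nat.add_sub_cancel' hnB.le]
    rw [mul_pow, ← pow_mul, mul_comm ((w : D) ^ p), hsplit, mul_comm n p] at h
    have h' : ϖ ^ (p * (B - n)) ∣ (w : D) ^ p :=
      (mul_dvd_mul_iff_left (pow_ne_zero _ hϖ.ne_zero)).mp h
    have hpos : p * (B - n) ≠ 0 := (Nat.mul_pos hp (Nat.sub_pos_of_lt hnB)).ne'
    have h1 : ϖ ∣ (w : D) ^ p := (dvd_pow_self ϖ hpos).trans h'
    exact hϖ.not_isUnit (isUnit_of_dvd_unit (hprime.dvd_of_dvd_pow h1) w.isUnit)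

/-- In a local ring, a unit minus an element of the maximal ideal is a unit. [folklore] -/
theorem isUnit_sub_of_mem_maximalIdeal {R : Type*} [CommRing R] [IsLocalRing R] {v m : R}
    (hv : IsUnit v) (hm : m ∈ IsLocalRing.maximalIdeal R) : IsUnit (v - m) := by
  by_contra h
  have h' : v - m ∈ IsLocalRing.maximalIdeal R := (IsLocalRing.mem_maximalIdeal _).mpr h
  have : v ∈ IsLocalRing.maximalIdeal R := by
    have := Ideal.add_mem _ h' hm
    rwa [sub_add_cancel] at this
  exact (IsLocalRing.mem_maximalIdeal _).mp this hv

/-- **The two types exclude each other** (in a discrete valuation ring of characteristic `p`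
with uniformizer `ϖ`): a wound `a = g^p + ϖ^{pB} u` is not of Kummer type
`a = g'^p + v ϖ^A`, `p ∤ A`. Indeed `v ϖ^A = (g - g')^p + ϖ^{pB} u`; if `pB ≤ A` then
`ϖ^B ∣ g - g'`, say `g - g' = ϖ^B e`, and `u + e^p = v ϖ^{A - pB}` is divisible by `ϖ`
(`A ≠ pB` as `p ∤ A`), contradicting woundness with `c = -e`; if `A < pB` then
`(g - g')^p = ϖ^A · unit`, so `p ∣ A`. [cite: Giraud1983, Prop. 1.5] -/
theorem IsWoundTypeAt.not_isKummerTypeAt (p : ℕ) [Fact p.Prime] [CharP D p] {ϖ : D}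
    (hϖ : Irreducible ϖ) {a : D} (hw : IsWoundTypeAt p ϖ a) : ¬ IsKummerTypeAt p ϖ a := by
  rintro ⟨g', v, A, hv, hA, ha'⟩
  obtain ⟨g, u, B, hu, ha⟩ := hw
  have hp : p.Prime := Fact.out
  have hϖ0 : ϖ ≠ 0 := hϖ.ne_zero
  have key : v * ϖ ^ A = (g - g') ^ p + ϖ ^ (p * B) * u := by
    rw [sub_pow_char]
    linear_combination ha'.symm.trans ha
  rcases le_or_gt (p * B) A with hle | hlt
  · have hsplit : ϖ ^ A = ϖ ^ (p * B) * ϖ ^ (A - p * B) := by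
      rw [← pow_add, Nat.add_sub_cancel' hle]
    have h1 : ϖ ^ (p * B) ∣ (g - g') ^ p :=
      ⟨v * ϖ ^ (A - p * B) - u, by linear_combination -key + v * hsplit⟩
    obtain ⟨e, he⟩ := pow_dvd_of_pow_mul_dvd_pow hϖ hp.pos h1
    -- `e^p + u = v ϖ^{A - pB}`
    have h2 : e ^ p + u = v * ϖ ^ (A - p * B) := by
      apply mul_left_cancel₀ (pow_ne_zero (p * B) hϖ0)
      have : (g - g') ^ p = ϖ ^ (p * B) * e ^ p := by rw [he, mul_pow, ← pow_mul, mul_comm B p]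
      linear_combination -key + v * hsplit - this
    rcases hle.eq_or_lt with heq | hlt'
    · exact hA ⟨B, heq.symm⟩
    · apply hu (-e)
      have hneg : (-e) ^ p = -(e ^ p) := by
        rw [neg_pow, neg_one_pow_char, neg_one_mul]
      rw [hneg, sub_neg_eq_add, add_comm, h2]
      exact Dvd.dvd.mul_left (dvd_pow_self ϖ (Nat.sub_pos_of_lt hlt').ne') v
  · -- `(g - g')^p = ϖ^A · (v - ϖ^{pB-A} u)`, a unit multiple of `ϖ^A`
    have hsplit : ϖ ^ (p * B) = ϖ ^ A * ϖ ^ (p * B - A) := by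
      rw [← pow_add, Nat.add_sub_cancel' hlt.le]
    have hw' : IsUnit (v - ϖ ^ (p * B - A) * u) := by
      refine isUnit_sub_of_mem_maximalIdeal hv (Ideal.mul_mem_right _ _ ?_)
      exact Ideal.pow_mem_of_mem _ ((IsLocalRing.mem_maximalIdeal _).mpr hϖ.not_isUnit) _
        (Nat.sub_pos_of_lt hlt)
    have h3 : (g - g') ^ p = hw'.unit * ϖ ^ A := by
      rw [IsUnit.unit_spec]
      linear_combination -key - u * hsplit
    have hδ : g - g' ≠ 0 := by
      intro h0
      rw [h0, zero_pow hp.ne_zero] at h3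
      exact (mul_ne_zero hw'.ne_zero (pow_ne_zero A hϖ0)) h3.symm
    obtain ⟨n, w₀, hw₀⟩ := IsDiscreteValuationRing.eq_unit_mul_pow_irreducible hδ hϖ
    have h4 : ((w₀ ^ p : Dˣ) : D) * ϖ ^ (n * p) = hw'.unit * ϖ ^ A := by
      rw [← h3, hw₀, mul_pow, ← pow_mul, Units.val_pow_eq_pow_val]
    have := IsDiscreteValuationRing.unit_mul_pow_congr_pow hϖ hϖ _ _ _ _ h4
    exact hA ⟨n, by rw [← this, mul_comm]⟩

end DVR

section Multiplicity

variable {S : Type*} [CommRing S] [IsDomain S]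

/-- **Multiplicity obstruction to `p`-th powers in the fraction field**: in a domain with
well-founded divisibility (e.g. Noetherian), if `y · t^p = s^p` with `t ≠ 0` and `p ≠ 0` then
the multiplicity of every prime element `π` in `y` is divisible by `p`. [folklore] -/
theorem dvd_multiplicity_of_mul_pow_eq_pow [WfDvdMonoid S] {π : S} (hπ : Prime π) {p : ℕ}
    (hp : p ≠ 0) {y s t : S} (ht : t ≠ 0) (h : y * t ^ p = s ^ p) {n : ℕ}
    (hn : emultiplicity π y = n) : p ∣ n := by
  by_cases hy : y = 0
  · subst hy
    rw [emultiplicity_zero] at hn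
    exact absurd hn (by simp)
  have hs : s ≠ 0 := by
    intro hs
    rw [hs, zero_pow hp] at h
    exact (mul_ne_zero hy (pow_ne_zero p ht)) h
  have hft := (FiniteMultiplicity.of_prime_left hπ ht).emultiplicity_eq_multiplicity
  have hfs := (FiniteMultiplicity.of_prime_left hπ hs).emultiplicity_eq_multiplicity
  have hmul := congrArg (emultiplicity π) h
  rw [emultiplicity_mul hπ, emultiplicity_pow hπ, emultiplicity_pow hπ, hn, hft, hfs] at hmul
  have hnat : n + p * multiplicity π t = p * multiplicity π s := by exact_mod_cast hmul
  have := Nat.dvd_sub (hnat ▸ dvd_mul_right p (multiplicity π s)) (dvd_mul_right p (multiplicity π t))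
  rwa [Nat.add_sub_cancel] at this

/-- The multiplicity of a prime `π` in `v · π^A · ∏_{i ∈ s} f_i^{k_i}` is `A` when `v` is a
unit and `π` divides no `f_i`. [folklore] -/
theorem emultiplicity_unit_mul_pow_mul_prod {π : S} (hπ : Prime π) {v : S} (hv : IsUnit v)
    (A : ℕ) {ι : Type*} (s : Finset ι) (f : ι → S) (k : ι → ℕ) (hf : ∀ i ∈ s, ¬ π ∣ f i) :
    emultiplicity π (v * π ^ A * ∏ i ∈ s, f i ^ k i) = A := by
  rw [emultiplicity_mul hπ, emultiplicity_mul hπ, Finset.emultiplicity_prod hπ,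
    emultiplicity_pow_self_of_prime hπ, emultiplicity_of_isUnit_right hπ.not_unit hv, zero_add]
  rw [Finset.sum_eq_zero fun i hi => ?_, add_zero]
  rw [emultiplicity_pow hπ, emultiplicity_eq_zero.mpr (hf i hi), mul_zero]

end Multiplicity

/-! ## Reading the type in the local ring of a point of the divisor

For a prime ideal `𝔮` of a ring `O` (the ideal of the divisor in the local ring of a point on
it) the discrete valuation ring of the divisor is the localisation `O_𝔮`; the following lemmas
produce the two types in `O_𝔮` from identities in `O`. -/

section AtPrime

variable {O : Type*} [CommRing O] (𝔮 : Ideal O) [𝔮.IsPrime]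
variable (L : Type*) [CommRing L] [Algebra O L] [IsLocalization.AtPrime L 𝔮]

/-- **Kummer type from a Kummer form at a point**: if `a = g^p + V · x^A` in `O` with `V ∉ 𝔮`
and `p ∤ A`, then `a` is of Kummer type along `x` in `O_𝔮`. [cite: Giraud1983, Prop. 1.5] -/
theorem isKummerTypeAt_algebraMap {p : ℕ} {a g V x : O} {A : ℕ} (hV : V ∉ 𝔮) (hA : ¬ p ∣ A)
    (ha : a = g ^ p + V * x ^ A) :
    IsKummerTypeAt p (algebraMap O L x) (algebraMap O L a) :=
  ⟨algebraMap O L g, algebraMap O L V, A,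
    (IsLocalization.AtPrime.isUnit_to_map_iff L 𝔮 V).mpr hV, hA, by simp [ha]⟩

/-- **Wound type from a wound form at a point**: if `a = g^p + x^{pB} · U` in `O` with `x ∈ 𝔮`
and `U` not a `p`-th power in the fraction field of `O/𝔮` — in the form
`∀ s t, t ∉ 𝔮 → U t^p - s^p ∉ 𝔮` — then `a` is of wound type along `x` in `O_𝔮`.
[cite: Giraud1983, Prop. 1.5] -/
theorem isWoundTypeAt_algebraMap {p : ℕ} {a g U x : O} {B : ℕ} (hx : x ∈ 𝔮)
    (hU : ∀ s t : O, t ∉ 𝔮 → U * t ^ p - s ^ p ∉ 𝔮) (ha : a = g ^ p + x ^ (p * B) * U) :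
    IsWoundTypeAt p (algebraMap O L x) (algebraMap O L a) := by
  haveI : IsLocalRing L := IsLocalization.AtPrime.isLocalRing L 𝔮
  refine ⟨algebraMap O L g, algebraMap O L U, B, fun c hc => ?_, by simp [ha]⟩
  obtain ⟨⟨s, t⟩, rfl⟩ := IsLocalization.mk'_surjective 𝔮.primeCompl c
  obtain ⟨d, hd⟩ := hc
  -- clear the denominator: `U t^p - s^p ↦ x · d · t^p ∈ 𝔪`
  have hmem : algebraMap O L (U * t ^ p - s ^ p) ∈ IsLocalRing.maximalIdeal L := by
    have ht : algebraMap O L (t : O) * IsLocalization.mk' L (1 : O) t = 1 := by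
      rw [IsLocalization.mul_mk'_eq_mk'_of_mul, mul_one, IsLocalization.mk'_self']
    have hs : IsLocalization.mk' L s t = algebraMap O L s * IsLocalization.mk' L (1 : O) t := by
      rw [IsLocalization.mul_mk'_eq_mk'_of_mul, mul_one]
    have key : algebraMap O L (U * t ^ p - s ^ p) =
        algebraMap O L x * (d * algebraMap O L (t : O) ^ p) := by
      have e1 : algebraMap O L (U * t ^ p - s ^ p) =
          (algebraMap O L U - (IsLocalization.mk' L s t) ^ p) * algebraMap O L (t : O) ^ p := by
        rw [hs, mul_pow, sub_mul, mul_assoc, ← mul_pow, mul_comm (IsLocalization.mk' L 1 t),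
          ht, one_pow, mul_one, map_sub, map_mul, map_pow, map_pow]
      rw [e1, hd, mul_assoc]
    rw [key]
    exact Ideal.mul_mem_right _ _ ((IsLocalization.AtPrime.to_map_mem_maximal_iff L 𝔮 x).mpr hx)
  exact hU s t t.2 ((IsLocalization.AtPrime.to_map_mem_maximal_iff L 𝔮 _).mp hmem)

omit [𝔮.IsPrime] in
/-- **Woundness from a multiplicity count in `O/𝔮`**: if the residue of `U` in the domain
`O/𝔮` (with well-founded divisibility) has multiplicity `n` prime to `p` at some prime element
`π`, then `U` is not a `p`-th power in the fraction field of `O/𝔮`: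
`∀ s t, t ∉ 𝔮 → U t^p - s^p ∉ 𝔮`. [folklore] -/
theorem forall_mul_pow_sub_pow_notMem_of_emultiplicity [IsDomain (O ⧸ 𝔮)] [WfDvdMonoid (O ⧸ 𝔮)]
    {p : ℕ} (hp : p ≠ 0) {U : O} {π : O ⧸ 𝔮} (hπ : Prime π) {n : ℕ}
    (hn : emultiplicity π (Ideal.Quotient.mk 𝔮 U) = n) (hpn : ¬ p ∣ n) :
    ∀ s t : O, t ∉ 𝔮 → U * t ^ p - s ^ p ∉ 𝔮 := by
  intro s t ht hmem
  apply hpn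
  refine dvd_multiplicity_of_mul_pow_eq_pow hπ hp (s := Ideal.Quotient.mk 𝔮 s)
    (t := Ideal.Quotient.mk 𝔮 t) ?_ ?_ hn
  · exact fun h => ht (Ideal.Quotient.eq_zero_iff_mem.mp h)
  · have := (Ideal.Quotient.eq_zero_iff_mem).mpr hmem
    rw [map_sub, map_mul, map_pow, map_pow, sub_eq_zero] at this
    exact this

/-- **Woundness from the normality of `O/𝔮`**: if `O/𝔮` is an integrally closed domain and
`U - e^p ∉ 𝔮` for every `e ∈ O`, then `U` is not a `p`-th power in the fraction field of `O/𝔮`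
either (`0 < p`). [folklore] -/
theorem forall_mul_pow_sub_pow_notMem_of_isIntegrallyClosed [IsDomain (O ⧸ 𝔮)]
    [IsIntegrallyClosed (O ⧸ 𝔮)] {p : ℕ} (hp : 0 < p) {U : O} (hU : ∀ e : O, U - e ^ p ∉ 𝔮) :
    ∀ s t : O, t ∉ 𝔮 → U * t ^ p - s ^ p ∉ 𝔮 := by
  intro s t ht hmem
  let K := FractionRing (O ⧸ 𝔮)
  have ht0 : (Ideal.Quotient.mk 𝔮 t : O ⧸ 𝔮) ≠ 0 :=
    fun h => ht (Ideal.Quotient.eq_zero_iff_mem.mp h)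
  have htK : algebraMap (O ⧸ 𝔮) K (Ideal.Quotient.mk 𝔮 t) ≠ 0 :=
    fun h => ht0 ((injective_iff_map_eq_zero _).mp (IsFractionRing.injective (O ⧸ 𝔮) K) _ h)
  -- `z = s̄ / t̄` has `z^p = Ū`
  set z : K := algebraMap (O ⧸ 𝔮) K (Ideal.Quotient.mk 𝔮 s) /
    algebraMap (O ⧸ 𝔮) K (Ideal.Quotient.mk 𝔮 t) with hz
  have hzp : z ^ p = algebraMap (O ⧸ 𝔮) K (Ideal.Quotient.mk 𝔮 U) := by
    have h1 : Ideal.Quotient.mk 𝔮 U * Ideal.Quotient.mk 𝔮 t ^ p = Ideal.Quotient.mk 𝔮 s ^ p := by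
      have := (Ideal.Quotient.eq_zero_iff_mem).mpr hmem
      rw [map_sub, map_mul, map_pow, map_pow, sub_eq_zero] at this
      exact this
    rw [hz, div_pow, div_eq_iff (pow_ne_zero p htK)]
    have h2 := congrArg (algebraMap (O ⧸ 𝔮) K) h1
    simp only [map_mul, map_pow] at h2
    exact h2.symm
  have hint : IsIntegral (O ⧸ 𝔮) (z ^ p) := hzp ▸ isIntegral_algebraMap
  obtain ⟨ē, hē⟩ := IsIntegrallyClosed.exists_algebraMap_eq_of_isIntegral_pow hp hint
  obtain ⟨e, rfl⟩ := Ideal.Quotient.mk_surjective ē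
  apply hU e
  rw [← Ideal.Quotient.eq_zero_iff_mem, map_sub, map_pow, sub_eq_zero]
  apply IsFractionRing.injective (O ⧸ 𝔮) K
  rw [map_pow, hē, hzp]

omit [𝔮.IsPrime] in
/-- **Wound-or-transversal at a point ⇒ wound along each boundary component through it**: in a
local ring `O` with boundary equations `x : Fin r → O` in the maximal ideal `𝔪`, if `U` is
wound-or-transversal (`IsWoundOrTransversalAt`) and `𝔮 ⊆ (x_1, …, x_r)` is a prime ideal
contained in `𝔪` (the ideal of a boundary component), then `U - e^p ∉ 𝔮` for all `e`
(`2 ≤ p`): in the transversal case `U - c^p ∈ 𝔪 ∖ (𝔪² + (x))`, and `U ≡ e^p (mod 𝔮)` would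
give `c - e ∈ 𝔪`, `U - c^p = (U - e^p) - (c - e)^p ∈ 𝔮 + 𝔪^p ⊆ 𝔪² + (x)`. [folklore] -/
theorem forall_sub_pow_notMem_of_isWoundOrTransversalAt [IsLocalRing O] {p : ℕ} [Fact p.Prime]
    [CharP O p] {r : ℕ} {x : Fin r → O} {U : O} (hU : IsWoundOrTransversalAt p x U)
    (h𝔮x : 𝔮 ≤ Ideal.span (Set.range x)) (h𝔮 : 𝔮 ≤ IsLocalRing.maximalIdeal O) :
    ∀ e : O, U - e ^ p ∉ 𝔮 := by
  have hp : p.Prime := Fact.out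
  intro e he
  rcases hU with hw | ⟨c, hc, hc2⟩
  · exact hw e (h𝔮 he)
  · apply hc2
    have hce : c - e ∈ IsLocalRing.maximalIdeal O := by
      have hmem : (c - e) ^ p ∈ IsLocalRing.maximalIdeal O := by
        rw [sub_pow_char]
        have : c ^ p - e ^ p = (U - e ^ p) - (U - c ^ p) := by ring
        rw [this]
        exact Ideal.sub_mem _ (h𝔮 he) hc
      exact (IsLocalRing.maximalIdeal.isMaximal O).isPrime.mem_of_pow_mem _ hmem
    have hdecomp : U - c ^ p = (U - e ^ p) - (c - e) ^ p := by rw [sub_pow_char]; ring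
    rw [hdecomp]
    refine Ideal.sub_mem _ (Ideal.mem_sup_right (h𝔮x he)) (Ideal.mem_sup_left ?_)
    exact Ideal.pow_le_pow_right hp.two_le (Ideal.pow_mem_pow hce p)

end AtPrime

end Literature.AlgebraicGeometry.Resolution
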